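import Summits.QuantumFields.BalabanUV.T4Continuum.Support.NE3ProjTangentLandauPoincare
import Summits.QuantumFields.BalabanUV.T4Continuum.Support.NE3FramePotBoundComplex
import HarnessLib

/-!
# NE3ProjTangentLandauCoercive (T⁴ programme, node NE3, row H5b of the owner's ruling ρ-g22-1 (R3), file 2∕2) — THE FRAME BOUND
# DISCHARGED (H4-ℂ) AND (ML_w)-FLAT ON THE CHART'S MIN-NORM SLICE IN CURL CURRENCY:
# `WeightedTangentCoercive L k 1 (projTangentLandau L N k) (1 ∕ (card n·(1 + C_P♮))) (periodBox (N·L^k))`,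
# `C_P♮ = card n·(9 + 2·2^{d−1} + 72·d·12·Dfp d L)` — N-FREE, k-FREE

NE3 (node U1b) formalisation swarm `b2b-balaban-t4-ne3-formalise-*`, leaf seat `b2b-balaban-t4-ne3-formalise-leaf-02` (gen 5), row
**H5b** (ρ-g21-4 (W4) ∕ ρ-g22-1 (R3)); ACK∕INTENT `HOME/CLAIMS.log` 2026-08-20 ≈16:27Z; file 1 = `NE3ProjTangentLandauPoincare`
(p226460).  All [folklore], 0 sorry, 0 def:
§1 **`weightedTangentCoercive_flatCfg_of_curlPoincare`** — the `_of_curlPoincare` twin of this lineage's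
   `NE3FlatWeightedCoercive.weightedTangentCoercive_flatCfg_of_poincare`: on ANY set `T` of skew directions, a CURL-CURRENCY Poincaré
   hypothesis `((L^k)⁻¹)²·dirSq Y F ≤ C·curlSq 1 Y F` (`C ≥ 0`) gives `WeightedTangentCoercive L k 1 T (1∕(card n·(1+C))) F` DIRECTLY from
   (w1) `NE3FlatHessianCurl.hess_flatCfg_ge_curlSq` (`(card n)⁻¹·curlSq ≤ hess`) — NO Weitzenböck, NO Landau∕`hdiv` clause, any `F`;
§2 the frame bound DISCHARGED by leaf-04-g5's H4-ℂ `NE3FramePotBoundComplex.sum_norm_framePot_sq_le_complex` (`C_F = 12·Dfp d L`,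
   `d ≥ 3`, `L ≥ 2`): **`sum_nhsNormSq_le_curl_projTangentLandau`** (HS currency), **`weightedPoincare_projTangentLandau`**
   (`∀ Y ∈ projTangentLandau L N k, ((L^k)⁻¹)²·dirSq Y (periodBox (N·L^k)) ≤ C_P♮·curlSq 1 Y (periodBox (N·L^k))`,
   `C_P♮ = card n·(9 + 2·2^{d−1} + 72·d·(12·Dfp d L))`) and **`weightedTangentCoercive_projTangentLandau`**:
   `WeightedTangentCoercive L k flatCfg (projTangentLandau L N k) (1 ∕ (card n·(1 + C_P♮))) (periodBox (N·L^k))` — (ML_w) AT THE FLAT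
   BACKGROUND ON THE CHART'S SLICE with a constant free of `k` and of the torus size `N` (ρ-g21-4 (W3) had it on the smaller
   full-Landau set `flatTangentLandau` via (72S); the slice that the chart's `tangent : Ψ 1 ∈ T` can actually be arranged to meet —
   `NE3ProjTangentLandauPoincare.exists_cornerGauge_mem_projTangentLandau` — is this one).
HONEST FRAMING.  Flat finite-torus assembly in OUR frame over landed rows H1∕H2∕H3∕H4∕H5a BY NAME; nothing about Bałaban's
minimisers; (P♮)∕(ML_w) at the CURVED background `W = cavg L U_B` (the two typed inequalities (μK-FR), (ζ-def) of ρ-g21-4 (W5)),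
T-E_w and NE3 are NOT proved; spine PROVED 0∕9; finite T⁴ rung (B)+1 — NOT infinite volume, NOT mass gap, NOT BetaPertH, NOT Clay.
ABSOLUTE RULE kept: no printed sentence is a hypothesis (context only: [Balaban1985PropagatorsII] Thm 3.3 (3.46); [Balaban1984PropagatorsII]
(2.153)).  PLACEMENT: `Summits/QuantumFields/BalabanUV/`; imports file 1 and leaf-04-g5's `NE3FramePotBoundComplex` BY NAME; moves
nothing.  HONEST DEPENDENCY: continuum YM on T⁴ ⇐ BetaPertH ∧ nine spine estimates (0/9 proved); BetaPertH ⇐ (D1) ∧ (D4) ∧ CAP+tail;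
G-an2-4 gates asym, D1 and NE2/3/4.
-/

set_option autoImplicit false

open scoped BigOperators Matrix.Norms.L2Operator
open Finset

namespace Summit.QuantumFields.BalabanUV.T4Continuum.NE3ProjTangentLandauCoercive

open Literature.MathematicalPhysics.QuantumFieldTheory.Balaban1983to89
open B7Prop1Explicit
open T4AveragingDeficitWall (IsSkewDir Plane curlAt curl curlSq dirSq)
open T4AveragingDeficitWallBoundary (periodBox mem_periodBox card_periodBox)
open AveragingDeficitPeriodicCounting (IsPeriodicDir)
open MinimalActionWitness (flatCfg)
open NE3TangentFlatStructure (framePot)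
open MatrixNorms (nhsNormSq nhsNormSq_nonneg)
open NE3EnergyWeightedShapes (WeightedTangentCoercive energyNormW)
open NE3FlatHessianCurl (hess_flatCfg_ge_curlSq)
open NE3FramePotBound (Dfp)
open NE3FramePotBoundComplex (sum_norm_framePot_sq_le_complex twelve_mul_Dfp_nonneg)
open NE3ProjTangentLandauPoincare (projTangentLandau sum_nhsNormSq_le_curl_of_frameBound
  weightedPoincare_projTangentLandau_of_frameBound)

noncomputable section

variable {d : ℕ} {n : Type*} [Fintype n] [DecidableEq n] [Nonempty n]

/-! ## §1 (ML_w)-flat from a curl-currency Poincaré hypothesis, on any set of skew directions -/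

/-- **(ML_w) AT THE FLAT BACKGROUND FROM A CURL-CURRENCY POINCARÉ INEQUALITY** (the `_of_curlPoincare` twin of
`NE3FlatWeightedCoercive.weightedTangentCoercive_flatCfg_of_poincare`): if every `Y ∈ T` is skew and
`((L^k)⁻¹)²·dirSq Y F ≤ C·curlSq 1 Y F` with `C ≥ 0`, then `WeightedTangentCoercive L k 1 T (1∕(card n·(1+C))) F` — since
`energyNormW² = curlSq + (L^k)⁻²·dirSq ≤ (1+C)·curlSq` and (w1) `(card n)⁻¹·curlSq ≤ hess 1 Y Y`.  No Weitzenböck, no Landau clause,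
any site set `F`. [folklore] -/
theorem weightedTangentCoercive_flatCfg_of_curlPoincare (L k : ℕ) {T : Set (Site d → Fin d → Matrix n n ℂ)}
    (hskew : ∀ Y ∈ T, IsSkewDir Y) {C : ℝ} (hC : 0 ≤ C) (F : Finset (Site d))
    (hP : ∀ Y ∈ T, (((L : ℝ) ^ k)⁻¹) ^ 2 * dirSq Y F ≤ C * curlSq (flatCfg (d := d) (n := n)) Y F) :
    WeightedTangentCoercive L k (flatCfg (d := d) (n := n)) T (1 / (Fintype.card n * (1 + C))) F := by
  intro Y hY
  have hn : (0 : ℝ) < Fintype.card n := by exact_mod_cast Fintype.card_pos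
  have hcurl : 0 ≤ curlSq (flatCfg (d := d) (n := n)) Y F := by unfold curlSq; positivity
  have hdir : 0 ≤ dirSq Y F := by unfold dirSq; positivity
  have hsq : energyNormW L k (flatCfg (d := d) (n := n)) Y F ^ 2
      = curlSq (flatCfg (d := d) (n := n)) Y F + (((L : ℝ) ^ k)⁻¹) ^ 2 * dirSq Y F := by
    unfold energyNormW
    rw [Real.sq_sqrt (by positivity)]
  have h1 := hess_flatCfg_ge_curlSq (hskew Y hY) F
  have h2 := hP Y hY
  rw [hsq]
  calc 1 / (Fintype.card n * (1 + C)) * (curlSq (flatCfg (d := d) (n := n)) Y F + (((L : ℝ) ^ k)⁻¹) ^ 2 * dirSq Y F)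
      ≤ 1 / (Fintype.card n * (1 + C)) * ((1 + C) * curlSq (flatCfg (d := d) (n := n)) Y F) :=
        mul_le_mul_of_nonneg_left (by linarith) (by positivity)
    _ = (Fintype.card n : ℝ)⁻¹ * curlSq (flatCfg (d := d) (n := n)) Y F := by
        field_simp
    _ ≤ _ := h1

/-! ## §2 The frame bound discharged: (P♮)-flat and (ML_w)-flat on the chart's slice, unconditionally, N-FREE -/

/-- **(P♮)-FLAT ON THE CHART'S MIN-NORM SLICE, HILBERT–SCHMIDT CURRENCY** (`d ≥ 3`, `L ≥ 2`, `N, k ≥ 1`): for `Y ∈ projTangentLandau L N k`,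
`Σ_{periodBox (N·L^k)} Σ_κ nhsNormSq (Y x κ) ≤ (9 + 2·2^{d−1} + 72·d·(12·Dfp d L))·(L^k)²·Σ_x Σ_π nhsNormSq (curlAt 1 Y x π)` — file 1's
END with `hFB` := leaf-04-g5's H4-ℂ `sum_norm_framePot_sq_le_complex`; no factor `n`, no `N`, no `k` in the constant. [folklore] -/
theorem sum_nhsNormSq_le_curl_projTangentLandau (hd : 3 ≤ d) {L N k : ℕ} (hL : 2 ≤ L) (hN : 1 ≤ N) (hk : 1 ≤ k)
    {Y : Site d → Fin d → Matrix n n ℂ} (hY : Y ∈ projTangentLandau (d := d) (n := n) L N k) :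
    ∑ x ∈ periodBox (d := d) (N * L ^ k), ∑ κ : Fin d, nhsNormSq (Y x κ)
      ≤ (9 + 2 * (2 : ℝ) ^ (d - 1) + 72 * d * (12 * Dfp d L)) * ((L : ℝ) ^ k) ^ 2
          * ∑ x ∈ periodBox (d := d) (N * L ^ k), ∑ π : Plane d,
              nhsNormSq (curlAt (flatCfg (d := d) (n := n)) Y x π.1.1 π.1.2) :=
  sum_nhsNormSq_le_curl_of_frameBound (by omega) hN hk (twelve_mul_Dfp_nonneg d L)
    (fun _ hη => sum_norm_framePot_sq_le_complex hd hL hN k hη) hY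

/-- **(P♮)-FLAT ON THE CHART'S MIN-NORM SLICE, OPERATOR-NORM ∕ CURL CURRENCY** (`d ≥ 3`, `L ≥ 2`, `N, k ≥ 1`):
`∀ Y ∈ projTangentLandau L N k, ((L^k)⁻¹)²·dirSq Y (periodBox (N·L^k)) ≤ C_P♮·curlSq 1 Y (periodBox (N·L^k))`,
`C_P♮ = card n·(9 + 2·2^{d−1} + 72·d·(12·Dfp d L))` — THE LOCATED INEQUALITY Φ3 := (P♮) of ruling ρ-g21-4 (W1) AT THE FLAT BACKGROUND
on the chart's slice, free of `k` and of the torus size. [folklore] -/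
theorem weightedPoincare_projTangentLandau (hd : 3 ≤ d) {L N k : ℕ} (hL : 2 ≤ L) (hN : 1 ≤ N) (hk : 1 ≤ k) :
    ∀ Y ∈ projTangentLandau (d := d) (n := n) L N k,
      (((L : ℝ) ^ k)⁻¹) ^ 2 * dirSq Y (periodBox (d := d) (N * L ^ k))
        ≤ (Fintype.card n * (9 + 2 * (2 : ℝ) ^ (d - 1) + 72 * d * (12 * Dfp d L)))
          * curlSq (flatCfg (d := d) (n := n)) Y (periodBox (d := d) (N * L ^ k)) :=
  weightedPoincare_projTangentLandau_of_frameBound (by omega) hN hk (twelve_mul_Dfp_nonneg d L)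
    (fun _ hη => sum_norm_framePot_sq_le_complex hd hL hN k hη)

/-- **(ML_w) AT THE FLAT BACKGROUND ON THE CHART'S MIN-NORM SLICE, N-FREE** (`d ≥ 3`, `L ≥ 2`, `N, k ≥ 1`):
`WeightedTangentCoercive L k flatCfg (projTangentLandau L N k) (1 ∕ (card n·(1 + C_P♮))) (periodBox (N·L^k))`,
`C_P♮ = card n·(9 + 2·2^{d−1} + 72·d·(12·Dfp d L))` — the weighted tangent coercivity leaf of the surviving variant (R3) at `W = 1`, on
the slice the chart's L1 representative can be arranged to lie in (`exists_cornerGauge_mem_projTangentLandau`), with a constant free of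
`k` and of `N`. [folklore] -/
theorem weightedTangentCoercive_projTangentLandau (hd : 3 ≤ d) {L N k : ℕ} (hL : 2 ≤ L) (hN : 1 ≤ N) (hk : 1 ≤ k) :
    WeightedTangentCoercive L k (flatCfg (d := d) (n := n)) (projTangentLandau L N k)
      (1 / (Fintype.card n * (1 + Fintype.card n * (9 + 2 * (2 : ℝ) ^ (d - 1) + 72 * d * (12 * Dfp d L)))))
      (periodBox (d := d) (N * L ^ k)) :=
  weightedTangentCoercive_flatCfg_of_curlPoincare L k (fun _ hY => hY.1)
    (by have := twelve_mul_Dfp_nonneg d L; positivity) _ (weightedPoincare_projTangentLandau hd hL hN hk)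

end

end Summit.QuantumFields.BalabanUV.T4Continuum.NE3ProjTangentLandauCoercive
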